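import Summits.AtomisticToContinuum.Crystallization.Theorems.FrustratedLawDichotomyPalmFrequency
import Summits.AtomisticToContinuum.Crystallization.Theorems.FrustratedLawDichotomyTextureToolkit
import Summits.AtomisticToContinuum.Crystallization.Theorems.ChartedPlanarOrderBondWalkTransport
import Summits.AtomisticToContinuum.Crystallization.Theorems.FrustratedLawDichotomyHardCoreUpgrade

/-!
# FrustratedLawDichotomy · crux `AperiodicFrustratedLawGap` (stmt-AtomisticToContinuum-27623) — THE FRUSTRATION FREQUENCY
# (decomp-a2c, prover hand 1, direct share, generation 6; sequel of `FrustratedLawDichotomyPalmFrequency`)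

Clauses (a) (hard core), (b) (point-stationarity) and (d) (texture) of the crux, with the crux's `let`-bound `Gy` / `TexBall` /
`Appr` VERBATIM, give a QUANTITATIVE law-level statement: for every slack `ε > 0` there is `C = C(δ, R₈ + ε) : ℕ`, NOT depending
on the law, such that every measurable set of configurations containing all configurations whose ROOT

* carries a two-sided `(1/8 + ε)`-fcc/hcp shell at a nearest-neighbour scale `d ≥ 7/10` (texture transfer I,
  `FrustratedLawDichotomyTextureFineShells`), AND
* is NOT robustly `1/20`-good, fcc nor hcp (texture transfer II, `FrustratedLawDichotomyTextureAllBad`),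

has Palm probability at least `1/C` (`inv_le_prob_frustratedFineRoot`); and likewise (`inv_le_prob_holeOrNonTRoot`, with
`C = C(δ, R₇ + ε)`) for every measurable set containing all configurations with a HOLE (a point within `R₇ + ε` of the root at
distance `≥ 1 − ε` from every atom) or a ROBUSTLY NON-TETRAHEDRAL BOND at the root (texture transfer III,
`FrustratedLawDichotomyTextureHolesOrNonT`).  Informally: under the crux's hypotheses a fraction
`≥ 1/C(δ, R₈ + ε)` of all atoms are MODERATELY DISTORTED CLOSE-PACKED SITES (fine up to `1/8 + ε`, but not `1/20`-good) — the
frequency factor of any closing argument «local price at a distorted close-packed site × frequency of such sites ≥ gap», uniform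
over all laws of the crux's class.  Ingredients: `ae_toolkit_of_texture` (hand 1, generation 4) at the root and at the fine atom
it produces, the re-rooting bookkeeping `fineRoot_of_fineShell` / `notRobustGood_reroot` / `nonTRoot_of_nonT`, and the mass-transport lemma
`measure_univ_le_mul_of_ubiquitous` (generation 6).

§4 is the DOOR this frequency opens, BY NAME on the crux (and its `PeriodicChargeSplit` copy):
`aperiodicFrustratedLawGap_of_frustrationPrice` — a measurable LOCAL EXCESS DENSITY `loc ≥ 0` on rooted configurations with a floor
`loc ≥ c₁ > 0` at frustrated roots (fine up to `1/8 + ε`, not robustly `1/20`-good) and the Theil-type law-level local lower bound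
`E_P[loc] ≤ E_P[rootEnergy] − e⋆` for every point-stationary `7/10`-hard-core probability law implies `AperiodicFrustratedLawGap`
(Markov + the frustration frequency + the landed hard-core upgrade `aperiodicFrustratedLawGap_iff_sep07`).  The priced local excess
density is the OPEN half (the 3-D local crystallization inequality); the frequency half is proved here.  All `[folklore]`.  No
definitions, no `sorry`.
-/

noncomputable section

namespace Summit.AtomisticToContinuum.Crystallization.Theorems.FrustratedLawDichotomyFrustrationFrequency

open MeasureTheory Metric Set Filter ProbabilityTheory
open scoped ENNReal
open Literature.Probability.Process
open Summit.AtomisticToContinuum.Crystallization.Theorems.FrustratedLawDichotomyPalmFrequency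
  (measure_univ_le_mul_of_ubiquitous map_sub_apply_singleton fineRoot_of_fineShell)
open Summit.AtomisticToContinuum.Crystallization.Theorems.FrustratedLawDichotomyTextureToolkit (ae_toolkit_of_texture)
open Summit.AtomisticToContinuum.Crystallization.Theorems.ChartedPlanarOrderBondWalkTransport (map_sub_zero')
open Summit.AtomisticToContinuum.Crystallization.Theorems.FrustratedLawDichotomyHardCoreUpgrade (aperiodicFrustratedLawGap_iff_sep07)

/-! ## §1. Re-rooting the robust-goodness test -/

/-- **Shifting a robustly good shell back.**  If the configuration re-rooted at `p`, `θ_p μ = μ.map (· − p)`, had a robustly `η`-good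
shell at its root along the labelling `t`, then `μ` has one at `p` along `u ↦ t u + p` (pure bookkeeping: the atoms of `θ_p μ` are the
`s − p`, `s` an atom of `μ`). [folklore] -/
theorem robustGood_shift (μ : Measure (EuclideanSpace ℝ (Fin 3))) (p : EuclideanSpace ℝ (Fin 3)) {K : Finset (EuclideanSpace ℝ (Fin 3))} {d η γ : ℝ}
    {A : EuclideanSpace ℝ (Fin 3) →ₗᵢ[ℝ] EuclideanSpace ℝ (Fin 3)} {t : ↥K → EuclideanSpace ℝ (Fin 3)}
    (ht : (0 < d ∧ 0 < γ ∧ η < 1 / 20 ∧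
          (∀ u : ↥K, (μ.map fun z : EuclideanSpace ℝ (Fin 3) => z - p) {t u} ≠ 0 ∧ ‖(t u - 0) - d • A (u : EuclideanSpace ℝ (Fin 3))‖ ≤ η * d) ∧
          (∀ s : EuclideanSpace ℝ (Fin 3), (μ.map fun z : EuclideanSpace ℝ (Fin 3) => z - p) {s} ≠ 0 → s ≠ 0 → d ≤ dist s 0) ∧
          (∃ s : EuclideanSpace ℝ (Fin 3), (μ.map fun z : EuclideanSpace ℝ (Fin 3) => z - p) {s} ≠ 0 ∧ s ≠ 0 ∧ dist s 0 ≤ d) ∧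
          (∀ s : EuclideanSpace ℝ (Fin 3), (μ.map fun z : EuclideanSpace ℝ (Fin 3) => z - p) {s} ≠ 0 → s ≠ 0 → dist s 0 < 13 / 10 * d + γ → dist s 0 ≤ 13 / 10 * d - γ ∧ s ∈ Set.range t))) :
    (0 < d ∧ 0 < γ ∧ η < 1 / 20 ∧
          (∀ u : ↥K, μ {(fun u => t u + p) u} ≠ 0 ∧ ‖((fun u => t u + p) u - p) - d • A (u : EuclideanSpace ℝ (Fin 3))‖ ≤ η * d) ∧
          (∀ s : EuclideanSpace ℝ (Fin 3), μ {s} ≠ 0 → s ≠ p → d ≤ dist s p) ∧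
          (∃ s : EuclideanSpace ℝ (Fin 3), μ {s} ≠ 0 ∧ s ≠ p ∧ dist s p ≤ d) ∧
          (∀ s : EuclideanSpace ℝ (Fin 3), μ {s} ≠ 0 → s ≠ p → dist s p < 13 / 10 * d + γ → dist s p ≤ 13 / 10 * d - γ ∧ s ∈ Set.range (fun u => t u + p))) := by
  have hat : ∀ s : EuclideanSpace ℝ (Fin 3), (μ.map fun z : EuclideanSpace ℝ (Fin 3) => z - p) {s} ≠ 0 ↔ μ {s + p} ≠ 0 := fun s => by
    rw [map_sub_apply_singleton]
  have hdist : ∀ s : EuclideanSpace ℝ (Fin 3), dist (s - p) 0 = dist s p := fun s => by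
    rw [dist_zero_right, dist_eq_norm]
  obtain ⟨hd, hγ, hη, h1, h2, h3, h4⟩ := ht
  refine ⟨hd, hγ, hη, fun u => ?_, fun s hs hsp => ?_, ?_, fun s hs hsp hlt => ?_⟩
  · obtain ⟨hu, hn⟩ := h1 u
    refine ⟨(hat _).1 hu, ?_⟩
    simpa only [sub_zero, add_sub_cancel_right] using hn
  · have hs' : (μ.map fun z : EuclideanSpace ℝ (Fin 3) => z - p) {s - p} ≠ 0 := by rw [hat, sub_add_cancel]; exact hs
    have h := h2 (s - p) hs' (sub_ne_zero.2 hsp)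
    rwa [hdist] at h
  · obtain ⟨s, hs, hs0, hsd⟩ := h3
    refine ⟨s + p, (hat s).1 hs, fun h => hs0 (by simpa using congrArg (· - p) h), ?_⟩
    have : dist (s + p) p = dist s 0 := by rw [dist_zero_right, dist_eq_norm, add_sub_cancel_right]
    rw [this]; exact hsd
  · have hs' : (μ.map fun z : EuclideanSpace ℝ (Fin 3) => z - p) {s - p} ≠ 0 := by rw [hat, sub_add_cancel]; exact hs
    have hlt' : dist (s - p) 0 < 13 / 10 * d + γ := by rw [hdist]; exact hlt
    obtain ⟨hle, u, hu⟩ := h4 (s - p) hs' (sub_ne_zero.2 hsp) hlt'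
    refine ⟨by rw [← hdist]; exact hle, u, ?_⟩
    show t u + p = s
    rw [hu, sub_add_cancel]

/-- **Re-rooting the «not robustly good» test.**  If `μ` is not robustly `1/20`-good at its atom `p` (texture transfer II at `p`, the
second conjunct of `toolkit_of_texture`), then `θ_p μ` is not robustly `1/20`-good at its root. [folklore] -/
theorem notRobustGood_reroot {μ : Measure (EuclideanSpace ℝ (Fin 3))} {p : EuclideanSpace ℝ (Fin 3)}
    (h : (∀ (d η γ : ℝ) (A : EuclideanSpace ℝ (Fin 3) →ₗᵢ[ℝ] EuclideanSpace ℝ (Fin 3)),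
      (∀ t : ↥Literature.Geometry.DiscreteGeometry.fccKissingPattern → EuclideanSpace ℝ (Fin 3),
        ¬ (0 < d ∧ 0 < γ ∧ η < 1 / 20 ∧
          (∀ u : ↥Literature.Geometry.DiscreteGeometry.fccKissingPattern, μ {t u} ≠ 0 ∧ ‖(t u - p) - d • A (u : EuclideanSpace ℝ (Fin 3))‖ ≤ η * d) ∧
          (∀ s : EuclideanSpace ℝ (Fin 3), μ {s} ≠ 0 → s ≠ p → d ≤ dist s p) ∧
          (∃ s : EuclideanSpace ℝ (Fin 3), μ {s} ≠ 0 ∧ s ≠ p ∧ dist s p ≤ d) ∧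
          (∀ s : EuclideanSpace ℝ (Fin 3), μ {s} ≠ 0 → s ≠ p → dist s p < 13 / 10 * d + γ → dist s p ≤ 13 / 10 * d - γ ∧ s ∈ Set.range t))) ∧
      (∀ t : ↥Literature.Geometry.DiscreteGeometry.hcpKissingPattern → EuclideanSpace ℝ (Fin 3),
        ¬ (0 < d ∧ 0 < γ ∧ η < 1 / 20 ∧
          (∀ u : ↥Literature.Geometry.DiscreteGeometry.hcpKissingPattern, μ {t u} ≠ 0 ∧ ‖(t u - p) - d • A (u : EuclideanSpace ℝ (Fin 3))‖ ≤ η * d) ∧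
          (∀ s : EuclideanSpace ℝ (Fin 3), μ {s} ≠ 0 → s ≠ p → d ≤ dist s p) ∧
          (∃ s : EuclideanSpace ℝ (Fin 3), μ {s} ≠ 0 ∧ s ≠ p ∧ dist s p ≤ d) ∧
          (∀ s : EuclideanSpace ℝ (Fin 3), μ {s} ≠ 0 → s ≠ p → dist s p < 13 / 10 * d + γ → dist s p ≤ 13 / 10 * d - γ ∧ s ∈ Set.range t))))) :
    (∀ (d η γ : ℝ) (A : EuclideanSpace ℝ (Fin 3) →ₗᵢ[ℝ] EuclideanSpace ℝ (Fin 3)),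
      (∀ t : ↥Literature.Geometry.DiscreteGeometry.fccKissingPattern → EuclideanSpace ℝ (Fin 3),
        ¬ (0 < d ∧ 0 < γ ∧ η < 1 / 20 ∧
          (∀ u : ↥Literature.Geometry.DiscreteGeometry.fccKissingPattern, (μ.map fun z : EuclideanSpace ℝ (Fin 3) => z - p) {t u} ≠ 0 ∧ ‖(t u - 0) - d • A (u : EuclideanSpace ℝ (Fin 3))‖ ≤ η * d) ∧
          (∀ s : EuclideanSpace ℝ (Fin 3), (μ.map fun z : EuclideanSpace ℝ (Fin 3) => z - p) {s} ≠ 0 → s ≠ 0 → d ≤ dist s 0) ∧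
          (∃ s : EuclideanSpace ℝ (Fin 3), (μ.map fun z : EuclideanSpace ℝ (Fin 3) => z - p) {s} ≠ 0 ∧ s ≠ 0 ∧ dist s 0 ≤ d) ∧
          (∀ s : EuclideanSpace ℝ (Fin 3), (μ.map fun z : EuclideanSpace ℝ (Fin 3) => z - p) {s} ≠ 0 → s ≠ 0 → dist s 0 < 13 / 10 * d + γ → dist s 0 ≤ 13 / 10 * d - γ ∧ s ∈ Set.range t))) ∧
      (∀ t : ↥Literature.Geometry.DiscreteGeometry.hcpKissingPattern → EuclideanSpace ℝ (Fin 3),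
        ¬ (0 < d ∧ 0 < γ ∧ η < 1 / 20 ∧
          (∀ u : ↥Literature.Geometry.DiscreteGeometry.hcpKissingPattern, (μ.map fun z : EuclideanSpace ℝ (Fin 3) => z - p) {t u} ≠ 0 ∧ ‖(t u - 0) - d • A (u : EuclideanSpace ℝ (Fin 3))‖ ≤ η * d) ∧
          (∀ s : EuclideanSpace ℝ (Fin 3), (μ.map fun z : EuclideanSpace ℝ (Fin 3) => z - p) {s} ≠ 0 → s ≠ 0 → d ≤ dist s 0) ∧
          (∃ s : EuclideanSpace ℝ (Fin 3), (μ.map fun z : EuclideanSpace ℝ (Fin 3) => z - p) {s} ≠ 0 ∧ s ≠ 0 ∧ dist s 0 ≤ d) ∧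
          (∀ s : EuclideanSpace ℝ (Fin 3), (μ.map fun z : EuclideanSpace ℝ (Fin 3) => z - p) {s} ≠ 0 → s ≠ 0 → dist s 0 < 13 / 10 * d + γ → dist s 0 ≤ 13 / 10 * d - γ ∧ s ∈ Set.range t)))) := by
  intro d η γ A
  obtain ⟨hf, hh⟩ := h d η γ A
  exact ⟨fun t ht => hf (fun u => t u + p) (robustGood_shift μ p ht),
    fun t ht => hh (fun u => t u + p) (robustGood_shift μ p ht)⟩

/-! ## §2. The frustration frequency under the crux's hypotheses -/

/-- **THE FRUSTRATION FREQUENCY (clauses (a) + (b) + (d) of `AperiodicFrustratedLawGap`, `let`s VERBATIM).**  For every `δ > 0`, fine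
radius `R₈` and slack `ε > 0` there is `C : ℕ` such that for every point-stationary probability law `P`, a.s. rooted `δ`-hard-core and
texture-charged with radii `R₇ R₈ R₉` (clause (d) verbatim), and every MEASURABLE set `A` of configurations containing all configurations
whose root carries a two-sided `(1/8 + ε)`-fcc/hcp shell at a nearest-neighbour scale `d ≥ 7/10` and is not robustly `1/20`-good:
`P A ≥ 1/C`.  [folklore] -/
theorem inv_le_prob_frustratedFineRoot :
    ∀ δ : ℝ, 0 < δ → ∀ R₈ ε : ℝ, 0 < ε → ∃ C : ℕ,
    ∀ P : MeasureTheory.Measure (MeasureTheory.Measure (EuclideanSpace ℝ (Fin 3))), let Gy : ℝ → (N : ℕ) → (Fin N → EuclideanSpace ℝ (Fin 3)) → Fin N → Prop := fun η N y j => let d : ℝ := sInf ((fun z => dist z (y (j : Fin N))) '' (Set.range (y) \ {(y (j : Fin N))})); let T : Set (EuclideanSpace ℝ (Fin 3)) := {z : EuclideanSpace ℝ (Fin 3) | z ∈ Set.range (y) ∧ z ≠ (y (j : Fin N)) ∧ dist z (y (j : Fin N)) < 13 / 10 * d}; ∃ A : EuclideanSpace ℝ (Fin 3) →ₗᵢ[ℝ]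 EuclideanSpace ℝ (Fin 3), (∃ e : ↥T ≃ ↥Literature.Geometry.DiscreteGeometry.fccKissingPattern, ∀ t : ↥T, dist (d⁻¹ • ((t : EuclideanSpace ℝ (Fin 3)) - (y (j : Fin N)))) (A ((e t : ↥Literature.Geometry.DiscreteGeometry.fccKissingPattern) : EuclideanSpace ℝ (Fin 3))) ≤ η) ∨ (∃ e : ↥T ≃ ↥Literature.Geometry.DiscreteGeometry.hcpKissingPattern, ∀ t : ↥T, dist (d⁻¹ • ((t : EuclideanSpace ℝ (Fin 3)) - (y (j : Fin N)))) (A ((e t : ↥Literature.Geometry.DiscreteGeometry.hcpKissingPattern) : EuclideanSpace ℝ (Fin 3))) ≤ η); let TexBall : (N : ℕ) → (Fin N → EuclideanSpace ℝ (Fin 3)) → Fin N → ℝ → ℝ → ℝ → ℝ → Prop := fun N y i R R₇ R₈ R₉ => (∀ a b : Fin N, a ≠ b → (7 : ℝ) / 10 ≤ dist (y a) (y b)) ∧ (∀ j : Fin N, dist (y j) (y i) ≤ R → ¬ Gy (1 / 20) N (y) j) ∧ (∀ j : Fin N, dist (y j) (y i) ≤ R → ¬ ((∀ j' : Fin N,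 dist (y j') (y j) ≤ R₇ → ¬ Gy (1 / 20) N (y) j') ∧ (∀ z : EuclideanSpace ℝ (Fin 3), dist z (y j) ≤ R₇ → ∃ k : Fin N, dist z (y k) ≤ 1) ∧ (∀ j' : Fin N, dist (y j') (y j) ≤ R₇ → (let d : ℝ := sInf ((fun z => dist z (y j')) '' (Set.range (y) \ {(y j')})); ∀ k : Fin N, y k ≠ y j' → dist (y k) (y j') < 27 / 20 * d → 5 ≤ Nat.card {m : Fin N // y m ≠ y j' ∧ dist (y m) (y j') < 27 / 20 * d ∧ y m ≠ y k ∧ dist (y m) (y k) < 27 / 20 * d})))) ∧ (∀ j : Fin N, dist (y j) (y i) ≤ R → ∃ k : Fin N, dist (y k) (y j) ≤ R₈ ∧ Gy (1 / 8) N (y) k) ∧ (∀ j : Fin N, dist (y j) (y i) ≤ R → ¬ ((∀ j' : Fin N, dist (y j') (y j) ≤ R₉ → ¬ Gy (1 / 20) N (y) j') ∧ (Nat.card {j' : Fin N // dist (y j') (y j) ≤ R₉ ∧ ¬ Gy (1 / 8) N (y) j'} : ℝ) ≤ 1 / 2 * (Nat.card {j' : Fin N // dist (y j') (y j) ≤ R₉}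 : ℝ) ∧ (∀ j' : Fin N, dist (y j') (y j) ≤ R₉ → ¬ Gy (1 / 8) N (y) j' → ¬ (let d : ℝ := sInf ((fun z => dist z (y j')) '' (Set.range (y) \ {(y j')})); ∀ k : Fin N, y k ≠ y j' → dist (y k) (y j') < 27 / 20 * d → 5 ≤ Nat.card {m : Fin N // y m ≠ y j' ∧ dist (y m) (y j') < 27 / 20 * d ∧ y m ≠ y k ∧ dist (y m) (y k) < 27 / 20 * d})))); let Appr : MeasureTheory.Measure (EuclideanSpace ℝ (Fin 3)) → ℝ → ℝ → ℝ → Prop := fun μ R₇ R₈ R₉ => ∀ q : EuclideanSpace ℝ (Fin 3), μ {q} ≠ 0 → ∀ R ε : ℝ, 0 < ε → ∃ (N : ℕ) (y : Fin N → EuclideanSpace ℝ (Fin 3)) (i : Fin N), TexBall N y i R R₇ R₈ R₉ ∧ (∀ p : EuclideanSpace ℝ (Fin 3), μ {p} ≠ 0 → dist p q ≤ R → ∃ k : Fin N, dist (y k - y i) (p - q) ≤ ε) ∧ (∀ k : Fin N, dist (y k) (y i) ≤ R → ∃ p : EuclideanSpace ℝ (Fin 3), μ {p} ≠ 0 ∧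 dist (y k - y i) (p - q) ≤ ε);  MeasureTheory.IsProbabilityMeasure P → (∀ᵐ μ ∂P, Literature.Probability.Process.IsRootedHardCore δ μ) → Literature.Probability.Process.IsPointStationaryLaw P → ∀ R₇ R₉ : ℝ, (∀ᵐ μ ∂P, Appr μ R₇ R₈ R₉) →
      ∀ A : Set (MeasureTheory.Measure (EuclideanSpace ℝ (Fin 3))), MeasurableSet A →
        (∀ ν : MeasureTheory.Measure (EuclideanSpace ℝ (Fin 3)),
          (∃ d : ℝ, (7 : ℝ) / 10 ≤ d ∧ (∀ s : EuclideanSpace ℝ (Fin 3), ν {s} ≠ 0 → s ≠ 0 → d ≤ ‖s‖ + ε) ∧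
            ∃ A : EuclideanSpace ℝ (Fin 3) →ₗᵢ[ℝ] EuclideanSpace ℝ (Fin 3),
              ((∀ u ∈ Literature.Geometry.DiscreteGeometry.fccKissingPattern, ∃ s : EuclideanSpace ℝ (Fin 3), ν {s} ≠ 0 ∧ dist s (d • A u) ≤ d / 8 + ε) ∧
                (∀ s : EuclideanSpace ℝ (Fin 3), ν {s} ≠ 0 → s ≠ 0 → ‖s‖ + ε ≤ 13 / 10 * d →
                  ∃ u ∈ Literature.Geometry.DiscreteGeometry.fccKissingPattern, dist s (d • A u) ≤ d / 8 + ε)) ∨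
              ((∀ u ∈ Literature.Geometry.DiscreteGeometry.hcpKissingPattern, ∃ s : EuclideanSpace ℝ (Fin 3), ν {s} ≠ 0 ∧ dist s (d • A u) ≤ d / 8 + ε) ∧
                (∀ s : EuclideanSpace ℝ (Fin 3), ν {s} ≠ 0 → s ≠ 0 → ‖s‖ + ε ≤ 13 / 10 * d →
                  ∃ u ∈ Literature.Geometry.DiscreteGeometry.hcpKissingPattern, dist s (d • A u) ≤ d / 8 + ε))) →
          (∀ (d η γ : ℝ) (A : EuclideanSpace ℝ (Fin 3) →ₗᵢ[ℝ] EuclideanSpace ℝ (Fin 3)),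
      (∀ t : ↥Literature.Geometry.DiscreteGeometry.fccKissingPattern → EuclideanSpace ℝ (Fin 3),
        ¬ (0 < d ∧ 0 < γ ∧ η < 1 / 20 ∧
          (∀ u : ↥Literature.Geometry.DiscreteGeometry.fccKissingPattern, ν {t u} ≠ 0 ∧ ‖(t u - 0) - d • A (u : EuclideanSpace ℝ (Fin 3))‖ ≤ η * d) ∧
          (∀ s : EuclideanSpace ℝ (Fin 3), ν {s} ≠ 0 → s ≠ 0 → d ≤ dist s 0) ∧
          (∃ s : EuclideanSpace ℝ (Fin 3), ν {s} ≠ 0 ∧ s ≠ 0 ∧ dist s 0 ≤ d) ∧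
          (∀ s : EuclideanSpace ℝ (Fin 3), ν {s} ≠ 0 → s ≠ 0 → dist s 0 < 13 / 10 * d + γ → dist s 0 ≤ 13 / 10 * d - γ ∧ s ∈ Set.range t))) ∧
      (∀ t : ↥Literature.Geometry.DiscreteGeometry.hcpKissingPattern → EuclideanSpace ℝ (Fin 3),
        ¬ (0 < d ∧ 0 < γ ∧ η < 1 / 20 ∧
          (∀ u : ↥Literature.Geometry.DiscreteGeometry.hcpKissingPattern, ν {t u} ≠ 0 ∧ ‖(t u - 0) - d • A (u : EuclideanSpace ℝ (Fin 3))‖ ≤ η * d) ∧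
          (∀ s : EuclideanSpace ℝ (Fin 3), ν {s} ≠ 0 → s ≠ 0 → d ≤ dist s 0) ∧
          (∃ s : EuclideanSpace ℝ (Fin 3), ν {s} ≠ 0 ∧ s ≠ 0 ∧ dist s 0 ≤ d) ∧
          (∀ s : EuclideanSpace ℝ (Fin 3), ν {s} ≠ 0 → s ≠ 0 → dist s 0 < 13 / 10 * d + γ → dist s 0 ≤ 13 / 10 * d - γ ∧ s ∈ Set.range t)))) → ν ∈ A) →
        (C : ℝ≥0∞)⁻¹ ≤ P A := by
  intro δ hδ R₈ ε hε
  obtain ⟨C, hC⟩ := measure_univ_le_mul_of_ubiquitous hδ (R₈ + ε)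
  refine ⟨C, fun P => ?_⟩
  dsimp only
  intro hP ha hb R₇ R₉ hd A hA hhull
  have htool := ae_toolkit_of_texture P
  dsimp only at htool
  have ht := htool δ hδ ha R₇ R₈ R₉ hd
  have hub : ∀ᵐ μ ∂P, ∃ x : EuclideanSpace ℝ (Fin 3), μ {x} ≠ 0 ∧ ‖x‖ ≤ R₈ + ε ∧ μ.map (fun z : EuclideanSpace ℝ (Fin 3) => z - x) ∈ A := by
    filter_upwards [ha, ht] with μ hμ hμt
    have h0 : μ {0} ≠ 0 := by
      obtain ⟨S, h0S, -, rfl⟩ := hμ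
      exact (count_restrict_singleton_ne_zero_iff S 0).2 h0S
    obtain ⟨⟨p', hp', hp'R, d, hd7, hnn, A', hsh⟩, -, -⟩ := hμt 0 h0 ε hε
    obtain ⟨-, hII, -⟩ := hμt p' hp' ε hε
    refine ⟨p', hp', by rwa [← dist_zero_right], hhull _ ⟨d, hd7, ?_⟩ (notRobustGood_reroot hII)⟩
    obtain ⟨hnn', hsh'⟩ := fineRoot_of_fineShell (μ := μ) (p' := p') (ε := ε) (d := d) hnn (A := A') hsh
    exact ⟨hnn', A', hsh'⟩
  have h := hC P ha hb A hA hub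
  rw [measure_univ] at h
  rw [← one_div]
  exact ENNReal.div_le_of_le_mul (by rwa [mul_comm] at h)

/-! ## §3. The frequency of holes or non-tetrahedral bonds at the root (texture transfer III) -/

/-- **Shifting a robustly non-tetrahedral bond to the root.**  If `μ` has, at its atom `p₁`, a near neighbour `p'` within `27/20·d' + ε`
sharing at most `4` common near neighbours (texture transfer III, second alternative, at `p₁`), then `θ_{p₁} μ` has the same at its root
(the atoms of `θ_{p₁} μ` are the `s − p₁`; the common-neighbour sets correspond under `m ↦ m + p₁`). [folklore] -/
theorem nonTRoot_of_nonT {μ : Measure (EuclideanSpace ℝ (Fin 3))} {p₁ : EuclideanSpace ℝ (Fin 3)} {ε : ℝ}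
    (h : ∃ d' : ℝ, (7 : ℝ) / 10 ≤ d' ∧
      (∀ s : EuclideanSpace ℝ (Fin 3), μ {s} ≠ 0 → s ≠ p₁ → d' ≤ dist s p₁ + ε) ∧ (∃ s : EuclideanSpace ℝ (Fin 3), μ {s} ≠ 0 ∧ s ≠ p₁ ∧ dist s p₁ ≤ d' + ε) ∧
      ∃ p' : EuclideanSpace ℝ (Fin 3), μ {p'} ≠ 0 ∧ p' ≠ p₁ ∧ dist p' p₁ ≤ 27 / 20 * d' + ε ∧
        Nat.card {m : EuclideanSpace ℝ (Fin 3) // μ {m} ≠ 0 ∧ m ≠ p₁ ∧ dist m p₁ + ε ≤ 27 / 20 * d' ∧ m ≠ p' ∧ dist m p' + ε ≤ 27 / 20 * d'} ≤ 4) :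
    ∃ d' : ℝ, (7 : ℝ) / 10 ≤ d' ∧
      (∀ s : EuclideanSpace ℝ (Fin 3), (μ.map fun z : EuclideanSpace ℝ (Fin 3) => z - p₁) {s} ≠ 0 → s ≠ 0 → d' ≤ dist s 0 + ε) ∧ (∃ s : EuclideanSpace ℝ (Fin 3), (μ.map fun z : EuclideanSpace ℝ (Fin 3) => z - p₁) {s} ≠ 0 ∧ s ≠ 0 ∧ dist s 0 ≤ d' + ε) ∧
      ∃ p' : EuclideanSpace ℝ (Fin 3), (μ.map fun z : EuclideanSpace ℝ (Fin 3) => z - p₁) {p'} ≠ 0 ∧ p' ≠ 0 ∧ dist p' 0 ≤ 27 / 20 * d' + ε ∧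
        Nat.card {m : EuclideanSpace ℝ (Fin 3) // (μ.map fun z : EuclideanSpace ℝ (Fin 3) => z - p₁) {m} ≠ 0 ∧ m ≠ 0 ∧ dist m 0 + ε ≤ 27 / 20 * d' ∧ m ≠ p' ∧ dist m p' + ε ≤ 27 / 20 * d'} ≤ 4 := by
  have hat : ∀ s : EuclideanSpace ℝ (Fin 3), (μ.map fun z : EuclideanSpace ℝ (Fin 3) => z - p₁) {s} ≠ 0 ↔ μ {s + p₁} ≠ 0 := fun s => by
    rw [map_sub_apply_singleton]
  have hne : ∀ s : EuclideanSpace ℝ (Fin 3), s ≠ 0 ↔ s + p₁ ≠ p₁ := fun s => by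
    constructor
    · intro h h'; exact h (by simpa using h')
    · intro h h'; exact h (by simp [h'])
  have hdist : ∀ s : EuclideanSpace ℝ (Fin 3), dist (s + p₁) p₁ = dist s 0 := fun s => by
    rw [dist_zero_right, dist_eq_norm, add_sub_cancel_right]
  obtain ⟨d', hd7, hnn, ⟨s₀, hs₀, hs₀p, hs₀d⟩, p', hp', hp'p, hp'd, hcard⟩ := h
  refine ⟨d', hd7, fun s hs hs0 => ?_, ⟨s₀ - p₁, ?_, sub_ne_zero.2 hs₀p, ?_⟩, p' - p₁, ?_, sub_ne_zero.2 hp'p, ?_, ?_⟩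
  · have := hnn (s + p₁) ((hat s).1 hs) ((hne s).1 hs0); rwa [hdist] at this
  · rw [hat, sub_add_cancel]; exact hs₀
  · rw [← hdist, sub_add_cancel]; exact hs₀d
  · rw [hat, sub_add_cancel]; exact hp'
  · rw [← hdist, sub_add_cancel]; exact hp'd
  · refine le_trans (le_of_eq (Nat.card_congr ?_)) hcard
    refine (Equiv.addRight p₁).subtypeEquiv fun m => ?_
    simp only [Equiv.coe_addRight]
    rw [hat m, hne m, hdist m, show dist (m + p₁) p' = dist m (p' - p₁) by
      rw [dist_eq_norm, dist_eq_norm]; congr 1; abel]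
    exact Iff.rfl.and (Iff.rfl.and (Iff.rfl.and ⟨fun ⟨h1, h2⟩ => ⟨fun h => h1 (by rw [← h, add_sub_cancel_right]), h2⟩,
      fun ⟨h1, h2⟩ => ⟨fun h => h1 (by rw [h, sub_add_cancel]), h2⟩⟩))

/-- **THE HOLE-OR-NON-T FREQUENCY (clauses (a) + (b) + (d) of `AperiodicFrustratedLawGap`, `let`s VERBATIM).**  For every `δ > 0`, solid
radius `R₇` and slack `ε > 0` there is `C : ℕ` such that for every point-stationary probability law `P`, a.s. rooted `δ`-hard-core and
texture-charged with radii `R₇ R₈ R₉`, and every MEASURABLE set `A` of configurations containing every configuration which EITHER has a point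
within `R₇ + ε` of the root at distance `≥ 1 − ε` from all atoms (a hole) OR whose root has a near neighbour sharing at most four common near
neighbours (a robustly non-tetrahedral bond at the root): `P A ≥ 1/C`.  Texture transfer III (`FrustratedLawDichotomyTextureHolesOrNonT`)
makes this set `(R₇ + ε)`-ubiquitous (witness: the root itself in the hole case, the carrier `p₁` of the bond otherwise). [folklore] -/
theorem inv_le_prob_holeOrNonTRoot :
    ∀ δ : ℝ, 0 < δ → ∀ R₇ ε : ℝ, 0 < ε → ∃ C : ℕ,
    ∀ P : MeasureTheory.Measure (MeasureTheory.Measure (EuclideanSpace ℝ (Fin 3))), let Gy : ℝ → (N : ℕ) → (Fin N → EuclideanSpace ℝ (Fin 3)) → Fin N → Prop := fun η N y j => let d : ℝ := sInf ((fun z => dist z (y (j : Fin N))) '' (Set.range (y) \ {(y (j : Fin N))})); let T : Set (EuclideanSpace ℝ (Fin 3)) := {z : EuclideanSpace ℝ (Fin 3) | z ∈ Set.range (y) ∧ z ≠ (y (j : Fin N)) ∧ dist z (y (j : Fin N)) < 13 / 10 * d}; ∃ A : EuclideanSpace ℝ (Fin 3) →ₗᵢ[ℝ] EuclideanSpace ℝ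 (Fin 3), (∃ e : ↥T ≃ ↥Literature.Geometry.DiscreteGeometry.fccKissingPattern, ∀ t : ↥T, dist (d⁻¹ • ((t : EuclideanSpace ℝ (Fin 3)) - (y (j : Fin N)))) (A ((e t : ↥Literature.Geometry.DiscreteGeometry.fccKissingPattern) : EuclideanSpace ℝ (Fin 3))) ≤ η) ∨ (∃ e : ↥T ≃ ↥Literature.Geometry.DiscreteGeometry.hcpKissingPattern, ∀ t : ↥T, dist (d⁻¹ • ((t : EuclideanSpace ℝ (Fin 3)) - (y (j : Fin N)))) (A ((e t : ↥Literature.Geometry.DiscreteGeometry.hcpKissingPattern) : EuclideanSpace ℝ (Fin 3))) ≤ η); let TexBall : (N : ℕ) → (Fin N → EuclideanSpace ℝ (Fin 3)) → Fin N → ℝ → ℝ → ℝ → ℝ → Prop := fun N y i R R₇ R₈ R₉ => (∀ a b : Fin N, a ≠ b → (7 : ℝ) / 10 ≤ dist (y a) (y b)) ∧ (∀ j : Fin N, dist (y j) (y i) ≤ R → ¬ Gy (1 / 20) N (y) j) ∧ (∀ j : Fin N, dist (y j) (y i) ≤ R → ¬ ((∀ j' : Fin N, dist (y j') (y j) ≤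 R₇ → ¬ Gy (1 / 20) N (y) j') ∧ (∀ z : EuclideanSpace ℝ (Fin 3), dist z (y j) ≤ R₇ → ∃ k : Fin N, dist z (y k) ≤ 1) ∧ (∀ j' : Fin N, dist (y j') (y j) ≤ R₇ → (let d : ℝ := sInf ((fun z => dist z (y j')) '' (Set.range (y) \ {(y j')})); ∀ k : Fin N, y k ≠ y j' → dist (y k) (y j') < 27 / 20 * d → 5 ≤ Nat.card {m : Fin N // y m ≠ y j' ∧ dist (y m) (y j') < 27 / 20 * d ∧ y m ≠ y k ∧ dist (y m) (y k) < 27 / 20 * d})))) ∧ (∀ j : Fin N, dist (y j) (y i) ≤ R → ∃ k : Fin N, dist (y k) (y j) ≤ R₈ ∧ Gy (1 / 8) N (y) k) ∧ (∀ j : Fin N, dist (y j) (y i) ≤ R → ¬ ((∀ j' : Fin N, dist (y j') (y j) ≤ R₉ → ¬ Gy (1 / 20) N (y) j') ∧ (Nat.card {j' : Fin N // dist (y j') (y j) ≤ R₉ ∧ ¬ Gy (1 / 8) N (y) j'} : ℝ) ≤ 1 / 2 * (Nat.card {j' : Fin N // dist (y j') (y j) ≤ R₉} : ℝ) ∧ (∀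 j' : Fin N, dist (y j') (y j) ≤ R₉ → ¬ Gy (1 / 8) N (y) j' → ¬ (let d : ℝ := sInf ((fun z => dist z (y j')) '' (Set.range (y) \ {(y j')})); ∀ k : Fin N, y k ≠ y j' → dist (y k) (y j') < 27 / 20 * d → 5 ≤ Nat.card {m : Fin N // y m ≠ y j' ∧ dist (y m) (y j') < 27 / 20 * d ∧ y m ≠ y k ∧ dist (y m) (y k) < 27 / 20 * d})))); let Appr : MeasureTheory.Measure (EuclideanSpace ℝ (Fin 3)) → ℝ → ℝ → ℝ → Prop := fun μ R₇ R₈ R₉ => ∀ q : EuclideanSpace ℝ (Fin 3), μ {q} ≠ 0 → ∀ R ε : ℝ, 0 < ε → ∃ (N : ℕ) (y : Fin N → EuclideanSpace ℝ (Fin 3)) (i : Fin N), TexBall N y i R R₇ R₈ R₉ ∧ (∀ p : EuclideanSpace ℝ (Fin 3), μ {p} ≠ 0 → dist p q ≤ R → ∃ k : Fin N, dist (y k - y i) (p - q) ≤ ε) ∧ (∀ k : Fin N, dist (y k) (y i) ≤ R → ∃ p : EuclideanSpace ℝ (Fin 3), μ {p} ≠ 0 ∧ dist (y k - y i) (p -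 q) ≤ ε);  MeasureTheory.IsProbabilityMeasure P → (∀ᵐ μ ∂P, Literature.Probability.Process.IsRootedHardCore δ μ) → Literature.Probability.Process.IsPointStationaryLaw P → ∀ R₈ R₉ : ℝ, (∀ᵐ μ ∂P, Appr μ R₇ R₈ R₉) →
      ∀ A : Set (MeasureTheory.Measure (EuclideanSpace ℝ (Fin 3))), MeasurableSet A →
        (∀ ν : MeasureTheory.Measure (EuclideanSpace ℝ (Fin 3)),
          ((∃ z : EuclideanSpace ℝ (Fin 3), ‖z‖ ≤ R₇ + ε ∧ ∀ s : EuclideanSpace ℝ (Fin 3), ν {s} ≠ 0 → 1 - ε ≤ dist s z) ∨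
          (∃ d' : ℝ, (7 : ℝ) / 10 ≤ d' ∧
      (∀ s : EuclideanSpace ℝ (Fin 3), ν {s} ≠ 0 → s ≠ 0 → d' ≤ dist s 0 + ε) ∧ (∃ s : EuclideanSpace ℝ (Fin 3), ν {s} ≠ 0 ∧ s ≠ 0 ∧ dist s 0 ≤ d' + ε) ∧
      ∃ p' : EuclideanSpace ℝ (Fin 3), ν {p'} ≠ 0 ∧ p' ≠ 0 ∧ dist p' 0 ≤ 27 / 20 * d' + ε ∧
        Nat.card {m : EuclideanSpace ℝ (Fin 3) // ν {m} ≠ 0 ∧ m ≠ 0 ∧ dist m 0 + ε ≤ 27 / 20 * d' ∧ m ≠ p' ∧ dist m p' + ε ≤ 27 / 20 * d'} ≤ 4)) → ν ∈ A) →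
        (C : ℝ≥0∞)⁻¹ ≤ P A := by
  intro δ hδ R₇ ε hε
  obtain ⟨C, hC⟩ := measure_univ_le_mul_of_ubiquitous hδ (R₇ + ε)
  refine ⟨C, fun P => ?_⟩
  dsimp only
  intro hP ha hb R₈ R₉ hd A hA hhull
  have htool := ae_toolkit_of_texture P
  dsimp only at htool
  have ht := htool δ hδ ha R₇ R₈ R₉ hd
  have hub : ∀ᵐ μ ∂P, ∃ x : EuclideanSpace ℝ (Fin 3), μ {x} ≠ 0 ∧ ‖x‖ ≤ R₇ + ε ∧ μ.map (fun z : EuclideanSpace ℝ (Fin 3) => z - x) ∈ A := by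
    filter_upwards [ha, ht] with μ hμ hμt
    have h0 : μ {0} ≠ 0 := by
      obtain ⟨S, h0S, -, rfl⟩ := hμ
      exact (count_restrict_singleton_ne_zero_iff S 0).2 h0S
    obtain ⟨-, -, hIII⟩ := hμt 0 h0 ε hε
    rcases hIII with ⟨z, hz, hfar⟩ | ⟨p₁, hp₁, hp₁R, hrest⟩
    · refine ⟨0, h0, ?_, ?_⟩
      · rw [norm_zero]; linarith [(dist_nonneg : (0:ℝ) ≤ dist z 0).trans hz]
      · rw [map_sub_zero' μ]
        exact hhull μ (Or.inl ⟨z, by rwa [← dist_zero_right], hfar⟩)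
    · exact ⟨p₁, hp₁, by rwa [← dist_zero_right], hhull _ (Or.inr (nonTRoot_of_nonT hrest))⟩
  have h := hC P ha hb A hA hub
  rw [measure_univ] at h
  rw [← one_div]
  exact ENNReal.div_le_of_le_mul (by rwa [mul_comm] at h)

/-! ## §4. The door: a FRUSTRATION-PRICED LOCAL EXCESS DENSITY closes the crux (the price is the open half; the frequency is §2) -/

/-- **DOOR — `AperiodicFrustratedLawGap` from a FRUSTRATION-PRICED LOCAL EXCESS DENSITY.**  Suppose there are a slack `ε > 0`, a price
`c₁ > 0` and a measurable LOCAL EXCESS DENSITY `loc ≥ 0` on rooted configurations such that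
(price) `loc ν ≥ c₁` whenever the root of `ν` carries a two-sided `(1/8 + ε)`-fcc/hcp shell and is not robustly `1/20`-good, and
(local lower bound, Theil-type, law form) `E_P[loc] ≤ E_P[rootEnergy] − e⋆` for EVERY point-stationary probability law almost surely carried
by rooted `7/10`-hard-core configurations.  Then the crux holds (BY NAME): for a law of its class with `E_P[rootEnergy] ≤ e⋆` the local
bound forces `E_P[loc] = 0`, while Markov and the frustration frequency (§2, `inv_le_prob_frustratedFineRoot`, at `δ = 7/10` after the landed
hard-core upgrade `aperiodicFrustratedLawGap_iff_sep07`) give `E_P[loc] ≥ c₁ · P(loc ≥ c₁) ≥ c₁ / C > 0`.  The hypothesis is the textbook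
shape of crystallization proofs (a localised energy excess with a floor at frustrated sites, cf. Theil 2006 in 2D) and is the OPEN half;
this theorem records that it is the ONLY missing half. [folklore] -/
theorem aperiodicFrustratedLawGap_of_frustrationPrice
    (hprice : (∃ ε : ℝ, 0 < ε ∧ ∃ c₁ : ℝ, 0 < c₁ ∧ ∃ loc : MeasureTheory.Measure (EuclideanSpace ℝ (Fin 3)) → ℝ≥0∞, Measurable loc ∧
      (∀ ν : MeasureTheory.Measure (EuclideanSpace ℝ (Fin 3)),
          (∃ d : ℝ, (7 : ℝ) / 10 ≤ d ∧ (∀ s : EuclideanSpace ℝ (Fin 3), ν {s} ≠ 0 → s ≠ 0 → d ≤ ‖s‖ + ε) ∧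
            ∃ A : EuclideanSpace ℝ (Fin 3) →ₗᵢ[ℝ] EuclideanSpace ℝ (Fin 3),
              ((∀ u ∈ Literature.Geometry.DiscreteGeometry.fccKissingPattern, ∃ s : EuclideanSpace ℝ (Fin 3), ν {s} ≠ 0 ∧ dist s (d • A u) ≤ d / 8 + ε) ∧
                (∀ s : EuclideanSpace ℝ (Fin 3), ν {s} ≠ 0 → s ≠ 0 → ‖s‖ + ε ≤ 13 / 10 * d →
                  ∃ u ∈ Literature.Geometry.DiscreteGeometry.fccKissingPattern, dist s (d • A u) ≤ d / 8 + ε)) ∨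
              ((∀ u ∈ Literature.Geometry.DiscreteGeometry.hcpKissingPattern, ∃ s : EuclideanSpace ℝ (Fin 3), ν {s} ≠ 0 ∧ dist s (d • A u) ≤ d / 8 + ε) ∧
                (∀ s : EuclideanSpace ℝ (Fin 3), ν {s} ≠ 0 → s ≠ 0 → ‖s‖ + ε ≤ 13 / 10 * d →
                  ∃ u ∈ Literature.Geometry.DiscreteGeometry.hcpKissingPattern, dist s (d • A u) ≤ d / 8 + ε))) →
          (∀ (d η γ : ℝ) (A : EuclideanSpace ℝ (Fin 3) →ₗᵢ[ℝ] EuclideanSpace ℝ (Fin 3)),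
      (∀ t : ↥Literature.Geometry.DiscreteGeometry.fccKissingPattern → EuclideanSpace ℝ (Fin 3),
        ¬ (0 < d ∧ 0 < γ ∧ η < 1 / 20 ∧
          (∀ u : ↥Literature.Geometry.DiscreteGeometry.fccKissingPattern, ν {t u} ≠ 0 ∧ ‖(t u - 0) - d • A (u : EuclideanSpace ℝ (Fin 3))‖ ≤ η * d) ∧
          (∀ s : EuclideanSpace ℝ (Fin 3), ν {s} ≠ 0 → s ≠ 0 → d ≤ dist s 0) ∧
          (∃ s : EuclideanSpace ℝ (Fin 3), ν {s} ≠ 0 ∧ s ≠ 0 ∧ dist s 0 ≤ d) ∧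
          (∀ s : EuclideanSpace ℝ (Fin 3), ν {s} ≠ 0 → s ≠ 0 → dist s 0 < 13 / 10 * d + γ → dist s 0 ≤ 13 / 10 * d - γ ∧ s ∈ Set.range t))) ∧
      (∀ t : ↥Literature.Geometry.DiscreteGeometry.hcpKissingPattern → EuclideanSpace ℝ (Fin 3),
        ¬ (0 < d ∧ 0 < γ ∧ η < 1 / 20 ∧
          (∀ u : ↥Literature.Geometry.DiscreteGeometry.hcpKissingPattern, ν {t u} ≠ 0 ∧ ‖(t u - 0) - d • A (u : EuclideanSpace ℝ (Fin 3))‖ ≤ η * d) ∧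
          (∀ s : EuclideanSpace ℝ (Fin 3), ν {s} ≠ 0 → s ≠ 0 → d ≤ dist s 0) ∧
          (∃ s : EuclideanSpace ℝ (Fin 3), ν {s} ≠ 0 ∧ s ≠ 0 ∧ dist s 0 ≤ d) ∧
          (∀ s : EuclideanSpace ℝ (Fin 3), ν {s} ≠ 0 → s ≠ 0 → dist s 0 < 13 / 10 * d + γ → dist s 0 ≤ 13 / 10 * d - γ ∧ s ∈ Set.range t)))) → ENNReal.ofReal c₁ ≤ loc ν) ∧
      (∀ P : MeasureTheory.Measure (MeasureTheory.Measure (EuclideanSpace ℝ (Fin 3))), MeasureTheory.IsProbabilityMeasure P →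
        (∀ᵐ μ ∂P, Literature.Probability.Process.IsRootedHardCore (7 / 10) μ) → Literature.Probability.Process.IsPointStationaryLaw P →
        ∫⁻ μ, loc μ ∂P ≤ ENNReal.ofReal ((∫ μ, Literature.MathematicalPhysics.StatisticalMechanics.rootEnergy Literature.MathematicalPhysics.StatisticalMechanics.lennardJones μ ∂P) -
          ⨅ Q : Literature.MathematicalPhysics.StatisticalMechanics.PeriodicConfiguration 3, Q.energyPerParticle Literature.MathematicalPhysics.StatisticalMechanics.lennardJones)))) :
    Summit.AtomisticToContinuum.Crystallization.Theses.FrustratedLawDichotomy.AperiodicFrustratedLawGap := by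
  obtain ⟨ε, hε, c₁, hc₁, loc, hloc, hfloor, hmean⟩ := hprice
  rw [aperiodicFrustratedLawGap_iff_sep07]
  intro P
  dsimp only
  intro hP ha hb hd he h0
  obtain ⟨R₇, R₈, R₉, hd'⟩ := hd
  obtain ⟨C, hC⟩ := inv_le_prob_frustratedFineRoot (7 / 10) (by norm_num) R₈ ε hε
  have hCP := hC P
  dsimp only at hCP
  by_contra hlt
  rw [not_lt] at hlt
  -- the local lower bound forces `E_P[loc] = 0`
  have hzero : ∫⁻ μ, loc μ ∂P = 0 := by
    have h := hmean P hP ha hb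
    rw [ENNReal.ofReal_eq_zero.2 (sub_nonpos.2 hlt)] at h
    exact le_zero_iff.1 h
  -- the frustration frequency: `P(loc ≥ c₁) ≥ 1/C`
  have hA : MeasurableSet {ν : MeasureTheory.Measure (EuclideanSpace ℝ (Fin 3)) | ENNReal.ofReal c₁ ≤ loc ν} :=
    measurableSet_le measurable_const hloc
  have hfreq : (C : ℝ≥0∞)⁻¹ ≤ P {ν : MeasureTheory.Measure (EuclideanSpace ℝ (Fin 3)) | ENNReal.ofReal c₁ ≤ loc ν} :=
    hCP hP ha hb R₇ R₉ hd' _ hA (fun ν hF hN => hfloor ν hF hN)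
  -- Markov
  have hmarkov : ENNReal.ofReal c₁ * P {ν : MeasureTheory.Measure (EuclideanSpace ℝ (Fin 3)) | ENNReal.ofReal c₁ ≤ loc ν} ≤ ∫⁻ μ, loc μ ∂P :=
    mul_meas_ge_le_lintegral hloc _
  have hpos : 0 < ENNReal.ofReal c₁ * (C : ℝ≥0∞)⁻¹ :=
    ENNReal.mul_pos (ENNReal.ofReal_pos.2 hc₁).ne' (ENNReal.inv_ne_zero.2 (ENNReal.natCast_ne_top C))
  have hle : ENNReal.ofReal c₁ * (C : ℝ≥0∞)⁻¹ ≤ 0 := by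
    calc ENNReal.ofReal c₁ * (C : ℝ≥0∞)⁻¹ ≤ ENNReal.ofReal c₁ * P {ν : MeasureTheory.Measure (EuclideanSpace ℝ (Fin 3)) | ENNReal.ofReal c₁ ≤ loc ν} := by
          gcongr
      _ ≤ ∫⁻ μ, loc μ ∂P := hmarkov
      _ = 0 := hzero
  exact absurd hle (not_le.2 hpos)

/-- The same door for the `PeriodicChargeSplit` copy of the shared crux decl (same statement). [folklore] -/
theorem periodicChargeSplit_aperiodicFrustratedLawGap_of_frustrationPrice
    (hprice : (∃ ε : ℝ, 0 < ε ∧ ∃ c₁ : ℝ, 0 < c₁ ∧ ∃ loc : MeasureTheory.Measure (EuclideanSpace ℝ (Fin 3)) → ℝ≥0∞, Measurable loc ∧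
      (∀ ν : MeasureTheory.Measure (EuclideanSpace ℝ (Fin 3)),
          (∃ d : ℝ, (7 : ℝ) / 10 ≤ d ∧ (∀ s : EuclideanSpace ℝ (Fin 3), ν {s} ≠ 0 → s ≠ 0 → d ≤ ‖s‖ + ε) ∧
            ∃ A : EuclideanSpace ℝ (Fin 3) →ₗᵢ[ℝ] EuclideanSpace ℝ (Fin 3),
              ((∀ u ∈ Literature.Geometry.DiscreteGeometry.fccKissingPattern, ∃ s : EuclideanSpace ℝ (Fin 3), ν {s} ≠ 0 ∧ dist s (d • A u) ≤ d / 8 + ε) ∧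
                (∀ s : EuclideanSpace ℝ (Fin 3), ν {s} ≠ 0 → s ≠ 0 → ‖s‖ + ε ≤ 13 / 10 * d →
                  ∃ u ∈ Literature.Geometry.DiscreteGeometry.fccKissingPattern, dist s (d • A u) ≤ d / 8 + ε)) ∨
              ((∀ u ∈ Literature.Geometry.DiscreteGeometry.hcpKissingPattern, ∃ s : EuclideanSpace ℝ (Fin 3), ν {s} ≠ 0 ∧ dist s (d • A u) ≤ d / 8 + ε) ∧
                (∀ s : EuclideanSpace ℝ (Fin 3), ν {s} ≠ 0 → s ≠ 0 → ‖s‖ + ε ≤ 13 / 10 * d →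
                  ∃ u ∈ Literature.Geometry.DiscreteGeometry.hcpKissingPattern, dist s (d • A u) ≤ d / 8 + ε))) →
          (∀ (d η γ : ℝ) (A : EuclideanSpace ℝ (Fin 3) →ₗᵢ[ℝ] EuclideanSpace ℝ (Fin 3)),
      (∀ t : ↥Literature.Geometry.DiscreteGeometry.fccKissingPattern → EuclideanSpace ℝ (Fin 3),
        ¬ (0 < d ∧ 0 < γ ∧ η < 1 / 20 ∧
          (∀ u : ↥Literature.Geometry.DiscreteGeometry.fccKissingPattern, ν {t u} ≠ 0 ∧ ‖(t u - 0) - d • A (u : EuclideanSpace ℝ (Fin 3))‖ ≤ η * d) ∧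
          (∀ s : EuclideanSpace ℝ (Fin 3), ν {s} ≠ 0 → s ≠ 0 → d ≤ dist s 0) ∧
          (∃ s : EuclideanSpace ℝ (Fin 3), ν {s} ≠ 0 ∧ s ≠ 0 ∧ dist s 0 ≤ d) ∧
          (∀ s : EuclideanSpace ℝ (Fin 3), ν {s} ≠ 0 → s ≠ 0 → dist s 0 < 13 / 10 * d + γ → dist s 0 ≤ 13 / 10 * d - γ ∧ s ∈ Set.range t))) ∧
      (∀ t : ↥Literature.Geometry.DiscreteGeometry.hcpKissingPattern → EuclideanSpace ℝ (Fin 3),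
        ¬ (0 < d ∧ 0 < γ ∧ η < 1 / 20 ∧
          (∀ u : ↥Literature.Geometry.DiscreteGeometry.hcpKissingPattern, ν {t u} ≠ 0 ∧ ‖(t u - 0) - d • A (u : EuclideanSpace ℝ (Fin 3))‖ ≤ η * d) ∧
          (∀ s : EuclideanSpace ℝ (Fin 3), ν {s} ≠ 0 → s ≠ 0 → d ≤ dist s 0) ∧
          (∃ s : EuclideanSpace ℝ (Fin 3), ν {s} ≠ 0 ∧ s ≠ 0 ∧ dist s 0 ≤ d) ∧
          (∀ s : EuclideanSpace ℝ (Fin 3), ν {s} ≠ 0 → s ≠ 0 → dist s 0 < 13 / 10 * d + γ → dist s 0 ≤ 13 / 10 * d - γ ∧ s ∈ Set.range t)))) → ENNReal.ofReal c₁ ≤ loc ν) ∧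
      (∀ P : MeasureTheory.Measure (MeasureTheory.Measure (EuclideanSpace ℝ (Fin 3))), MeasureTheory.IsProbabilityMeasure P →
        (∀ᵐ μ ∂P, Literature.Probability.Process.IsRootedHardCore (7 / 10) μ) → Literature.Probability.Process.IsPointStationaryLaw P →
        ∫⁻ μ, loc μ ∂P ≤ ENNReal.ofReal ((∫ μ, Literature.MathematicalPhysics.StatisticalMechanics.rootEnergy Literature.MathematicalPhysics.StatisticalMechanics.lennardJones μ ∂P) -
          ⨅ Q : Literature.MathematicalPhysics.StatisticalMechanics.PeriodicConfiguration 3, Q.energyPerParticle Literature.MathematicalPhysics.StatisticalMechanics.lennardJones)))) :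
    Summit.AtomisticToContinuum.Crystallization.Theses.PeriodicChargeSplit.AperiodicFrustratedLawGap :=
  aperiodicFrustratedLawGap_of_frustrationPrice hprice

end Summit.AtomisticToContinuum.Crystallization.Theorems.FrustratedLawDichotomyFrustrationFrequency

end
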